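import Mathlib.NumberTheory.Harmonic.ZetaAsymp
import Mathlib.Analysis.Calculus.DSlope
import Literature.NumberTheory.LFunctions.ZetaLogDerivDisc
import Literature.NumberTheory.LFunctions.EulerMaclaurinZeta
import Literature.NumberTheory.LFunctions.MertensBoundRH
import Literature.Analysis.Complex.VerticalLineIntegrals
import Literature.NumberTheory.LFunctions.PerronKernel
import HarnessLib

/-!
# Bettin–Gonek 2017, §2: the kernel `G_t`, its decay, and its vertical-line integrals

Second file of the discharge of `Literature.Barriers.RiemannHypothesis.BettinGonek2017_thm1`
(S. Bettin, S. M. Gonek, *The θ = ∞ conjecture implies the Riemann hypothesis*, Mathematika 63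
(2017) 29–33 = arXiv:1604.02740, Theorem 1), independent of `BettinGonek2017Proofs.lean`.
The printed proof (§2, p. 4) introduces, for a zero `ρ₀ = β₀ + iγ₀` of `ζ` with `β₀ ≥ ½` and a
real `t`, the kernel
`G_t(w) = (w−1)²(w−3/2+it)ζ(w−½+it) / ((w+1)²(w−½+it−ρ₀)(w+it+1)⁴)`,
holomorphic on `Re w ≥ 0` with `G_t(w) ≪ (1+|w+it|)^{-5/2}`, and
`g_t(u) = (1/2πi)∫_(3) G_t(w) u^{-w} dw`, `= 0` for `u > 1` and `O(1)` for `0 ≤ u ≤ 1`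
(moving the line to `+∞`, resp. to `Re w = 0`). Everything here is PROVED:

* `BettinGonek2017.zetaQuot ρ₀ = dslope riemannZeta₁ ρ₀`, the entire function
  `(z−1)ζ(z)/(z−ρ₀)`, with `‖zetaQuot ρ₀ z‖ ≤ (‖z‖+2)⁴` for `Re z ≥ −1`, `‖z − ρ₀‖ ≥ 1`
  (`norm_riemannZeta₁_le_pow_four`, from the tree's Euler–Maclaurin bound
  `Literature.NumberTheory.LFunctions.norm_riemannZeta_le_of_neg_one_le_re`).
* `BettinGonek2017.kernel ρ₀ t` = `G_t` **with the damping exponent `6` in place of the printed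
  `4`** (design choice: the cubic Euler–Maclaurin growth of `ζ` on `Re z = −½` then gives
  `‖G_t(w)‖ ≤ 625/(1 + (Im w + t)²)` on `Re w ≥ 0` away from `ρ₀`, `norm_kernel_le'`; the printed
  exponent `4` would need the convexity bound `ζ(−½+iτ) ≪ |τ|`). The residue of §2 changes only
  by `(ρ₀ + 3/2)⁴ ↦ (ρ₀ + 3/2)⁶`, immaterial for Theorem 1.
* `BettinGonek2017.kernelLine ρ₀ t σ r = ∫ G_t(σ+iv) r^{σ+iv} dv` (`2π g_t(1/r)` at `σ = 3`):
  line shifting on `Re w ≥ 0` (`kernelLine_eq_kernelLine`, by the tree's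
  `Literature.NumberTheory.LFunctions.MertensBoundRH.integral_vertical_eq_of_tendsto`),
  `kernelLine_three_eq_zero` (`r < 1`: `g_t(u) = 0` for `u > 1`) and
  `norm_kernelLine_three_le` (`r ≥ 1`: `‖·‖ ≤ 625π`, i.e. `g_t = O(1)`).
* `BettinGonek2017.ratFun ρ₀ t`, the rational function `G_t H_t`, and
  `kernel_mul_inv_eq_ratFun`: `G_t(w)/((w−1)²ζ(w−½+it)) = ratFun` on `Re w > 3/2`.

## References

* [BettinGonek2017] S. Bettin, S. M. Gonek, Mathematika 63 (2017) 29–33; arXiv:1604.02740, §2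
  (p. 4: `G_t`, `g_t`, the bounds `g_t(u) = 0` (`u > 1`), `O(1)` (`0 ≤ u ≤ 1`)).
* [Edwards1974] H. M. Edwards, *Riemann's Zeta Function* (1974), §6.4 (Euler–Maclaurin for `ζ`).
-/

noncomputable section

open Complex MeasureTheory Set Filter Real

namespace Literature.Barriers.RiemannHypothesis

namespace BettinGonek2017

/-! ## Growth of `(s-1)ζ(s)` on `Re s ≥ -1` -/

/-- Polynomial growth of the entire function `riemannZeta₁ = (s−1)ζ(s)` on `Re s ≥ −1`:
`‖(s−1)ζ(s)‖ ≤ (‖s‖ + 2)⁴` (from the Euler–Maclaurin bound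
`‖ζ(s)‖ ≤ 1/‖s−1‖ + ½ + ‖s‖/12 + ‖s‖‖s+1‖‖s+2‖/48` of `EulerMaclaurinZeta.lean`).
[cite: Edwards1974, §6.4 eq. (1)] -/
theorem norm_riemannZeta₁_le_pow_four {z : ℂ} (hz : -1 ≤ z.re) : ‖riemannZeta₁ z‖ ≤ (‖z‖ + 2) ^ 4 := by
  have hp2 : 2 ≤ ‖z‖ + 2 := by linarith [norm_nonneg z]
  rcases eq_or_ne z 1 with h1 | h1
  · subst h1; rw [riemannZeta₁_one]; norm_num
  rw [Literature.NumberTheory.LFunctions.riemannZeta₁_eq_mul h1, norm_mul]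
  have hζ := Literature.NumberTheory.LFunctions.norm_riemannZeta_le_of_neg_one_le_re hz h1
  have h0 : 0 < ‖z - 1‖ := norm_pos_iff.2 (sub_ne_zero.2 h1)
  set p : ℝ := ‖z‖ + 2 with hp
  have hz1 : ‖z - 1‖ ≤ p := (norm_sub_le _ _).trans (by simp [hp])
  have hz2 : ‖z + 1‖ ≤ p := (norm_add_le _ _).trans (by simp [hp])
  have hz3 : ‖z + 2‖ ≤ p := (norm_add_le _ _).trans (by simp [hp])
  have hz0 : ‖z‖ ≤ p := by linarith [hp]
  calc ‖z - 1‖ * ‖riemannZeta z‖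
      ≤ ‖z - 1‖ * (1 / ‖z - 1‖ + 1 / 2 + ‖z‖ / 12 + ‖z‖ * ‖z + 1‖ * ‖z + 2‖ / 48) := by gcongr
    _ = 1 + ‖z - 1‖ * (1 / 2 + ‖z‖ / 12 + ‖z‖ * ‖z + 1‖ * ‖z + 2‖ / 48) := by
        field_simp; ring
    _ ≤ 1 + p * (1 / 2 + p / 12 + p * p * p / 48) := by gcongr
    _ ≤ p ^ 4 := by
        have h2 : (4 : ℝ) ≤ p ^ 2 := by nlinarith
        have h3 : (8 : ℝ) ≤ p ^ 3 := by nlinarith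
        nlinarith

/-! ## The entire function `(z−1)ζ(z)/(z−ρ₀)` -/

/-- For a zero `ρ₀` of `ζ`: the entire function `(z − 1)ζ(z)/(z − ρ₀)` (value `((s−1)ζ)'(ρ₀)` at
`z = ρ₀`), realised as `dslope riemannZeta₁ ρ₀`. This is the factor
`(w − 3/2 + it) ζ(w − ½ + it)/(w − ½ + it − ρ₀)` of Bettin–Gonek's kernel `G_t`, evaluated at
`z = w − ½ + it`. [cite: BettinGonek2017, §2] -/
def zetaQuot (ρ₀ : ℂ) : ℂ → ℂ := dslope riemannZeta₁ ρ₀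

/-- `zetaQuot ρ₀` is entire. [cite: BettinGonek2017, §2] -/
theorem differentiable_zetaQuot (ρ₀ : ℂ) : Differentiable ℂ (zetaQuot ρ₀) := by
  rw [← differentiableOn_univ]
  exact (differentiableOn_dslope Filter.univ_mem).2 differentiable_riemannZeta₁.differentiableOn

/-- Off `ρ₀`, `zetaQuot ρ₀ z = (z−1)ζ(z)/(z−ρ₀)` (as `riemannZeta₁ ρ₀ = 0`).
[cite: BettinGonek2017, §2] -/
theorem zetaQuot_eq {ρ₀ z : ℂ} (hζ : riemannZeta ρ₀ = 0) (hz : z ≠ ρ₀) :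
    zetaQuot ρ₀ z = riemannZeta₁ z / (z - ρ₀) := by
  have h0 : riemannZeta₁ ρ₀ = 0 := by
    rw [Literature.NumberTheory.LFunctions.riemannZeta₁_eq_mul (Literature.NumberTheory.LFunctions.ne_one_of_riemannZeta_eq_zero hζ), hζ,
      mul_zero]
  rw [zetaQuot, dslope_of_ne _ hz, slope_def_field, h0, sub_zero]

/-- `‖zetaQuot ρ₀ z‖ ≤ (‖z‖ + 2)⁴` when `Re z ≥ −1` and `‖z − ρ₀‖ ≥ 1`.
[cite: BettinGonek2017, §2] -/
theorem norm_zetaQuot_le {ρ₀ z : ℂ} (hζ : riemannZeta ρ₀ = 0) (hz : -1 ≤ z.re)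
    (hd : 1 ≤ ‖z - ρ₀‖) : ‖zetaQuot ρ₀ z‖ ≤ (‖z‖ + 2) ^ 4 := by
  have hne : z ≠ ρ₀ := by
    intro h; rw [h, sub_self, norm_zero] at hd; linarith
  rw [zetaQuot_eq hζ hne, norm_div]
  calc ‖riemannZeta₁ z‖ / ‖z - ρ₀‖ ≤ ‖riemannZeta₁ z‖ / 1 :=
        div_le_div_of_nonneg_left (norm_nonneg _) one_pos hd
    _ ≤ (‖z‖ + 2) ^ 4 := by rw [div_one]; exact norm_riemannZeta₁_le_pow_four hz

/-! ## The kernel `G_t` -/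

/-- Bettin–Gonek's kernel with a stronger polynomial damping (exponent `6` instead of the printed
`4`, so that the cubic Euler–Maclaurin growth bound for `ζ` suffices on `Re w = 0`):
`G_t(w) = (w−1)² (w−3/2+it) ζ(w−½+it) / ((w+1)² (w−½+it−ρ₀) (w+1+it)⁶)`, written with the entire
factor `zetaQuot ρ₀ (w − ½ + it)`; holomorphic on `Re w > −1`. [cite: BettinGonek2017, §2] -/
def kernel (ρ₀ : ℂ) (t : ℝ) (w : ℂ) : ℂ :=
  (w - 1) ^ 2 * zetaQuot ρ₀ (w - 1 / 2 + t * I) / ((w + 1) ^ 2 * (w + 1 + t * I) ^ 6)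

/-- The denominator of `G_t` does not vanish on `Re w > −1`. [cite: BettinGonek2017, §2] -/
theorem kernel_den_ne_zero {t : ℝ} {w : ℂ} (hw : -1 < w.re) :
    (w + 1) ^ 2 * (w + 1 + t * I) ^ 6 ≠ 0 := by
  apply mul_ne_zero <;> apply pow_ne_zero
  · intro h; have := congrArg Complex.re h; simp at this; linarith
  · intro h; have := congrArg Complex.re h; simp at this; linarith

/-- `G_t` is holomorphic on `Re w > −1`. [cite: BettinGonek2017, §2] -/
theorem differentiableOn_kernel (ρ₀ : ℂ) (t : ℝ) :
    DifferentiableOn ℂ (kernel ρ₀ t) {w : ℂ | -1 < w.re} := by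
  intro w hw
  apply DifferentiableAt.differentiableWithinAt
  unfold kernel
  refine DifferentiableAt.div (by
    exact ((differentiableAt_id.sub_const 1).pow 2).mul
      (((differentiable_zetaQuot ρ₀).differentiableAt).comp w (by fun_prop))) (by fun_prop)
    (kernel_den_ne_zero hw)

/-- `G_t` is continuous on `Re w > −1`. [cite: BettinGonek2017, §2] -/
theorem continuousOn_kernel (ρ₀ : ℂ) (t : ℝ) :
    ContinuousOn (kernel ρ₀ t) {w : ℂ | -1 < w.re} :=
  (differentiableOn_kernel ρ₀ t).continuousOn

/-- For `Re w ≥ 0`: `‖w − 1‖ ≤ ‖w + 1‖`. [folklore] -/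
theorem norm_sub_one_le_norm_add_one {w : ℂ} (hw : 0 ≤ w.re) : ‖w - 1‖ ≤ ‖w + 1‖ := by
  rw [← sq_le_sq₀ (norm_nonneg _) (norm_nonneg _), Complex.sq_norm, Complex.sq_norm,
    Complex.normSq_apply, Complex.normSq_apply]
  simp only [sub_re, one_re, sub_im, one_im, sub_zero, add_re, add_im, add_zero]
  nlinarith

/-- **Decay of the kernel.** For `Re w ≥ 0` and `‖w − ½ + it − ρ₀‖ ≥ 1` (`ρ₀` a zero of `ζ`):
`‖G_t(w)‖ ≤ 625/‖w + 1 + it‖²`. [cite: BettinGonek2017, §2] -/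
theorem norm_kernel_le {ρ₀ : ℂ} (hζ : riemannZeta ρ₀ = 0) {t : ℝ} {w : ℂ} (hw : 0 ≤ w.re)
    (hd : 1 ≤ ‖w - 1 / 2 + t * I - ρ₀‖) :
    ‖kernel ρ₀ t w‖ ≤ 625 / ‖w + 1 + t * I‖ ^ 2 := by
  set q : ℂ := w + 1 + t * I with hq
  have hq1 : 1 ≤ ‖q‖ := by
    have := abs_re_le_norm q
    have hre : q.re = w.re + 1 := by simp [hq]
    rw [hre, abs_of_nonneg (by linarith)] at this
    linarith
  have hq0 : 0 < ‖q‖ := by linarith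
  have hz : -1 ≤ (w - 1 / 2 + t * I).re := by simp; linarith
  have hZ := norm_zetaQuot_le hζ hz hd
  have hzq : ‖w - 1 / 2 + t * I‖ + 2 ≤ 5 * ‖q‖ := by
    have : w - 1 / 2 + t * I = q - 3 / 2 := by rw [hq]; ring
    rw [this]
    calc ‖q - 3 / 2‖ + 2 ≤ ‖q‖ + ‖(3 / 2 : ℂ)‖ + 2 := by gcongr; exact norm_sub_le _ _
      _ = ‖q‖ + 7 / 2 := by norm_num; ring
      _ ≤ 5 * ‖q‖ := by linarith
  have hw1 : ‖w + 1‖ ≠ 0 := by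
    intro h; rw [norm_eq_zero] at h
    have := congrArg Complex.re h; simp at this; linarith
  unfold kernel
  rw [norm_div, norm_mul, norm_mul, norm_pow, norm_pow, norm_pow, ← hq]
  calc ‖w - 1‖ ^ 2 * ‖zetaQuot ρ₀ (w - 1 / 2 + t * I)‖ / (‖w + 1‖ ^ 2 * ‖q‖ ^ 6)
      ≤ ‖w + 1‖ ^ 2 * (5 * ‖q‖) ^ 4 / (‖w + 1‖ ^ 2 * ‖q‖ ^ 6) := by
        gcongr
        · exact norm_sub_one_le_norm_add_one hw
        · exact hZ.trans (by gcongr)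
    _ = 625 / ‖q‖ ^ 2 := by
        field_simp
        ring

/-- `‖w + 1 + it‖² ≥ 1 + (Im w + t)²` for `Re w ≥ 0`. [folklore] -/
theorem one_add_sq_le_norm_sq {w : ℂ} (hw : 0 ≤ w.re) (t : ℝ) :
    1 + (w.im + t) ^ 2 ≤ ‖w + 1 + t * I‖ ^ 2 := by
  rw [Complex.sq_norm, Complex.normSq_apply]
  simp only [add_re, one_re, mul_re, ofReal_re, I_re, mul_zero, ofReal_im, I_im, mul_one,
    sub_self, add_zero, add_im, one_im, mul_im]
  nlinarith

/-- The decay of the kernel in the form used for the line integrals: for `Re w ≥ 0` and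
`‖w − ½ + it − ρ₀‖ ≥ 1`, `‖G_t(w)‖ ≤ 625/(1 + (Im w + t)²)`. [cite: BettinGonek2017, §2] -/
theorem norm_kernel_le' {ρ₀ : ℂ} (hζ : riemannZeta ρ₀ = 0) {t : ℝ} {w : ℂ} (hw : 0 ≤ w.re)
    (hd : 1 ≤ ‖w - 1 / 2 + t * I - ρ₀‖) :
    ‖kernel ρ₀ t w‖ ≤ 625 / (1 + (w.im + t) ^ 2) :=
  (norm_kernel_le hζ hw hd).trans
    (div_le_div_of_nonneg_left (by norm_num) (by positivity) (one_add_sq_le_norm_sq hw t))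

/-- The three situations in which `‖w − ½ + it − ρ₀‖ ≥ 1` holds (`½ ≤ Re ρ₀ < 1`):
on `Re w = 0`, on `Re w ≥ 5/2`, and when `|Im w + t − Im ρ₀| ≥ 1`. [cite: BettinGonek2017, §2] -/
theorem one_le_norm_sub_rho {ρ₀ : ℂ} (hζ : riemannZeta ρ₀ = 0) (hβ : 1 / 2 ≤ ρ₀.re) {t : ℝ}
    {w : ℂ} (h : w.re = 0 ∨ 5 / 2 ≤ w.re ∨ 1 ≤ |w.im + t - ρ₀.im|) :
    1 ≤ ‖w - 1 / 2 + t * I - ρ₀‖ := by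
  have hβ1 := Literature.NumberTheory.LFunctions.re_lt_one_of_riemannZeta_eq_zero hζ
  set z : ℂ := w - 1 / 2 + t * I - ρ₀ with hz
  have hre : z.re = w.re - 1 / 2 - ρ₀.re := by simp [hz]
  have him : z.im = w.im + t - ρ₀.im := by simp [hz]
  rcases h with h | h | h
  · have := abs_re_le_norm z
    rw [hre, h] at this
    have : |0 - 1 / 2 - ρ₀.re| = 1 / 2 + ρ₀.re := by
      rw [abs_of_neg (by linarith)]; ring
    linarith
  · have := abs_re_le_norm z
    rw [hre, abs_of_nonneg (by linarith)] at this
    linarith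
  · have := abs_im_le_norm z
    rw [him] at this
    linarith

/-! ## Line integrals of the kernel: `k(σ, r) = ∫ G_t(σ+iv) r^{σ+iv} dv` -/

/-- The vertical-line integral `∫_{Re w = σ} G_t(w) r^w |dw|` (as an integral over `v = Im w`);
`(1/2π) k(σ, 1/u)` is Bettin–Gonek's `g_t(u)` when `σ = 3`. [cite: BettinGonek2017, §2] -/
def kernelLine (ρ₀ : ℂ) (t σ r : ℝ) : ℂ :=
  ∫ v : ℝ, kernel ρ₀ t (σ + v * I) * (r : ℂ) ^ ((σ : ℂ) + v * I)

/-- `v ↦ G_t(σ + iv)` is continuous for `σ > −1`. [cite: BettinGonek2017, §2] -/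
theorem continuous_kernel_line (ρ₀ : ℂ) (t : ℝ) {σ : ℝ} (hσ : -1 < σ) :
    Continuous fun v : ℝ ↦ kernel ρ₀ t (σ + v * I) :=
  (continuousOn_kernel ρ₀ t).comp_continuous (by fun_prop) fun v ↦ by simp [hσ]

/-- `v ↦ r^{σ+iv}` is continuous (`r > 0`). [folklore] -/
theorem continuous_cpow_line {r : ℝ} (hr : 0 < r) (σ : ℝ) :
    Continuous fun v : ℝ ↦ (r : ℂ) ^ ((σ : ℂ) + v * I) :=
  continuous_const.cpow (by fun_prop) fun _ ↦ Complex.ofReal_mem_slitPlane.2 hr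

/-- Decay of the line integrand away from the critical ordinate: for `σ ≥ 0`, `r > 0` and
`|v| ≥ 2|t| + |Im ρ₀| + 1`, `‖G_t(σ+iv) r^{σ+iv}‖ ≤ 2500 r^σ (1+v²)⁻¹`. [cite: BettinGonek2017, §2] -/
theorem norm_kernel_line_le {ρ₀ : ℂ} (hζ : riemannZeta ρ₀ = 0) (hβ : 1 / 2 ≤ ρ₀.re) (t : ℝ)
    {σ : ℝ} (hσ : 0 ≤ σ) {r : ℝ} (hr : 0 < r) {v : ℝ} (hv : 2 * |t| + |ρ₀.im| + 1 ≤ |v|) :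
    ‖kernel ρ₀ t (σ + v * I) * (r : ℂ) ^ ((σ : ℂ) + v * I)‖ ≤ 2500 * r ^ σ * (1 + v ^ 2)⁻¹ := by
  have hd : 1 ≤ ‖(σ : ℂ) + v * I - 1 / 2 + t * I - ρ₀‖ := by
    refine one_le_norm_sub_rho hζ hβ (Or.inr (Or.inr ?_))
    simp only [add_im, ofReal_im, mul_im, ofReal_re, I_im, mul_one, I_re, mul_zero, add_zero,
      zero_add]
    have h1 : |v| ≤ |v + t - ρ₀.im| + |t| + |ρ₀.im| := by
      have := abs_add_le (v + t - ρ₀.im) (ρ₀.im - t)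
      have h2 : |ρ₀.im - t| ≤ |ρ₀.im| + |t| := abs_sub _ _
      have h3 : v + t - ρ₀.im + (ρ₀.im - t) = v := by ring
      rw [h3] at this; linarith
    linarith [abs_nonneg t]
  have hk := norm_kernel_le' hζ (w := σ + v * I) (by simp [hσ]) hd
  simp only [add_im, ofReal_im, mul_im, ofReal_re, I_im, mul_one, I_re, mul_zero, add_zero,
    zero_add] at hk
  have hvt : (1 + v ^ 2) / 4 ≤ 1 + (v + t) ^ 2 := by
    have h1 : |v| / 2 ≤ |v + t| := by
      have h3 : |v| - |t| ≤ |v + t| := by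
        have := abs_add_le (v + t) (-t)
        rw [abs_neg, add_neg_cancel_right] at this
        linarith
      linarith [abs_nonneg (ρ₀.im), abs_nonneg t]
    have h2 : (|v| / 2) ^ 2 ≤ |v + t| ^ 2 := by gcongr
    rw [div_pow, sq_abs, sq_abs] at h2
    nlinarith
  rw [norm_mul, Literature.NumberTheory.LFunctions.norm_cpow_line hr]
  have hpos : 0 < 1 + v ^ 2 := by positivity
  calc ‖kernel ρ₀ t (σ + v * I)‖ * r ^ σ ≤ 625 / (1 + (v + t) ^ 2) * r ^ σ := by gcongr
    _ ≤ 625 / ((1 + v ^ 2) / 4) * r ^ σ := by gcongr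
    _ = 2500 * r ^ σ * (1 + v ^ 2)⁻¹ := by field_simp; ring

/-- The line integrand is integrable on every line `Re w = σ ≥ 0` (`r > 0`).
[cite: BettinGonek2017, §2] -/
theorem integrable_kernel_line {ρ₀ : ℂ} (hζ : riemannZeta ρ₀ = 0) (hβ : 1 / 2 ≤ ρ₀.re) (t : ℝ)
    {σ : ℝ} (hσ : 0 ≤ σ) {r : ℝ} (hr : 0 < r) :
    Integrable fun v : ℝ ↦ kernel ρ₀ t (σ + v * I) * (r : ℂ) ^ ((σ : ℂ) + v * I) :=
  Literature.Analysis.Complex.VLI.integrable_of_continuous_of_norm_le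
    ((continuous_kernel_line ρ₀ t (by linarith)).mul (continuous_cpow_line hr σ))
    fun _ hv ↦ norm_kernel_line_le hζ hβ t hσ hr hv

/-- **Moving the line of integration** (no poles of `G_t(w) r^w` on `Re w ≥ 0`): for
`0 ≤ a ≤ b` and `r > 0`, `k(a, r) = k(b, r)`. [cite: BettinGonek2017, §2] -/
theorem kernelLine_eq_kernelLine {ρ₀ : ℂ} (hζ : riemannZeta ρ₀ = 0) (hβ : 1 / 2 ≤ ρ₀.re)
    (t : ℝ) {a b : ℝ} (ha : 0 ≤ a) (hab : a ≤ b) {r : ℝ} (hr : 0 < r) :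
    kernelLine ρ₀ t a r = kernelLine ρ₀ t b r := by
  set F : ℂ → ℂ := fun w ↦ kernel ρ₀ t w * (r : ℂ) ^ w with hF
  have hFd : DifferentiableOn ℂ F (Icc a b ×ℂ univ) := by
    refine DifferentiableOn.mul ((differentiableOn_kernel ρ₀ t).mono fun w hw ↦ ?_)
      fun w _ ↦ (differentiableAt_id.const_cpow (Or.inl (by exact_mod_cast hr.ne'))).differentiableWithinAt
    have := (mem_reProdIm.1 hw).1.1
    simp only [mem_setOf_eq]; linarith
  have key := Literature.NumberTheory.LFunctions.MertensBoundRH.integral_vertical_eq_of_tendsto F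
    hab hFd (integrable_kernel_line hζ hβ t ha hr)
    (integrable_kernel_line hζ hβ t (ha.trans hab) hr) ?_
  · simpa [kernelLine, hF] using key
  -- uniform decay on the strip, from the `C/|T|` form
  set M : ℝ := max (r ^ a) (r ^ b) with hM
  refine Literature.Analysis.Complex.VLI.decay_of_norm_le_div (C := 2500 * M)
    (R := 2 * |t| + |ρ₀.im| + 1) fun σ hσ T hT ↦ ?_
  have hσ0 : 0 ≤ σ := ha.trans hσ.1
  have hrσ : r ^ σ ≤ M := by
    rcases le_or_gt 1 r with hr1 | hr1
    · exact (Real.rpow_le_rpow_of_exponent_le hr1 hσ.2).trans (le_max_right _ _)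
    · exact (Real.rpow_le_rpow_of_exponent_ge hr hr1.le hσ.1).trans (le_max_left _ _)
  have hT1 : 1 ≤ |T| := by linarith [abs_nonneg t, abs_nonneg ρ₀.im]
  have hT0 : 0 < |T| := by linarith
  calc ‖F (σ + T * I)‖ ≤ 2500 * r ^ σ * (1 + T ^ 2)⁻¹ := norm_kernel_line_le hζ hβ t hσ0 hr hT
    _ ≤ 2500 * M * (1 + T ^ 2)⁻¹ := by gcongr
    _ ≤ 2500 * M * |T|⁻¹ := by
        gcongr
        rw [← sq_abs]; nlinarith
    _ = 2500 * M / |T| := by rw [div_eq_mul_inv]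

/-- `v ↦ 625/(1 + (v+t)²)` is integrable with integral `625π`. [folklore] -/
theorem integral_decay_shift (t : ℝ) :
    Integrable (fun v : ℝ ↦ 625 / (1 + (v + t) ^ 2)) ∧
      ∫ v : ℝ, 625 / (1 + (v + t) ^ 2) = 625 * π := by
  have h1 : (fun v : ℝ ↦ 625 / (1 + (v + t) ^ 2)) = fun v ↦ (fun u : ℝ ↦ 625 * (1 + u ^ 2)⁻¹) (v + t) := by
    funext v; simp [div_eq_mul_inv]
  rw [h1]
  refine ⟨(integrable_inv_one_add_sq.const_mul 625).comp_add_right t, ?_⟩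
  rw [integral_add_right_eq_self (fun u : ℝ ↦ 625 * (1 + u ^ 2)⁻¹) t, integral_const_mul,
    integral_univ_inv_one_add_sq]

/-- On a line where the decay bound holds for every ordinate (`Re w = 0`, or `Re w ≥ 5/2`),
`‖k(σ, r)‖ ≤ 625π r^σ`. [cite: BettinGonek2017, §2] -/
theorem norm_kernelLine_le {ρ₀ : ℂ} (hζ : riemannZeta ρ₀ = 0) (hβ : 1 / 2 ≤ ρ₀.re) (t : ℝ)
    {σ : ℝ} (hσ : σ = 0 ∨ 5 / 2 ≤ σ) {r : ℝ} (hr : 0 < r) :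
    ‖kernelLine ρ₀ t σ r‖ ≤ 625 * π * r ^ σ := by
  have hσ0 : 0 ≤ σ := by rcases hσ with h | h <;> linarith
  obtain ⟨hint, hval⟩ := integral_decay_shift t
  unfold kernelLine
  calc ‖∫ v : ℝ, kernel ρ₀ t (σ + v * I) * (r : ℂ) ^ ((σ : ℂ) + v * I)‖
      ≤ ∫ v : ℝ, 625 / (1 + (v + t) ^ 2) * r ^ σ := by
        refine norm_integral_le_of_norm_le (hint.mul_const _) (Eventually.of_forall fun v ↦ ?_)
        rw [norm_mul, Literature.NumberTheory.LFunctions.norm_cpow_line hr]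
        gcongr
        have hd : 1 ≤ ‖(σ : ℂ) + v * I - 1 / 2 + t * I - ρ₀‖ := by
          refine one_le_norm_sub_rho hζ hβ ?_
          rcases hσ with h | h
          · left; simp [h]
          · right; left; simpa using h
        have := norm_kernel_le' hζ (w := σ + v * I) (by simp [hσ0]) hd
        simpa using this
    _ = 625 * π * r ^ σ := by rw [integral_mul_const, hval]

/-- **`g_t(u) = 0` for `u > 1`**: for `0 < r < 1`, `k(3, r) = 0` (move the line to `Re w = c → +∞`,
where `‖k(c, r)‖ ≤ 625π r^c → 0`). [cite: BettinGonek2017, §2] -/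
theorem kernelLine_three_eq_zero {ρ₀ : ℂ} (hζ : riemannZeta ρ₀ = 0) (hβ : 1 / 2 ≤ ρ₀.re)
    (t : ℝ) {r : ℝ} (hr : 0 < r) (hr1 : r < 1) : kernelLine ρ₀ t 3 r = 0 := by
  by_contra hne
  have hpos : 0 < ‖kernelLine ρ₀ t 3 r‖ := norm_pos_iff.2 hne
  have hlim : Tendsto (fun c : ℝ ↦ 625 * π * r ^ c) atTop (nhds 0) := by
    have := (tendsto_rpow_atTop_of_base_lt_one r (by linarith) hr1).const_mul (625 * π)
    simpa using this
  obtain ⟨c, hc1, hc2⟩ := ((hlim.eventually (gt_mem_nhds hpos)).and (eventually_ge_atTop 3)).exists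
  have heq := kernelLine_eq_kernelLine hζ hβ t (by norm_num : (0 : ℝ) ≤ 3) hc2 hr
  have hle := norm_kernelLine_le hζ hβ t (σ := c) (Or.inr (by linarith)) hr
  rw [← heq] at hle
  linarith

/-- **`g_t(u) = O(1)` for `u ≤ 1`**: for `r ≥ 1`, `‖k(3, r)‖ ≤ 625π` (move the line to `Re w = 0`).
[cite: BettinGonek2017, §2] -/
theorem norm_kernelLine_three_le {ρ₀ : ℂ} (hζ : riemannZeta ρ₀ = 0) (hβ : 1 / 2 ≤ ρ₀.re)
    (t : ℝ) {r : ℝ} (hr : 1 ≤ r) : ‖kernelLine ρ₀ t 3 r‖ ≤ 625 * π := by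
  have hr0 : 0 < r := by linarith
  rw [← kernelLine_eq_kernelLine hζ hβ t le_rfl (by norm_num : (0 : ℝ) ≤ 3) hr0]
  simpa using norm_kernelLine_le hζ hβ t (σ := 0) (Or.inl rfl) hr0

/-- The two bounds together: for `r > 0`, `‖k(3, r)‖ ≤ 625π · 𝟙[r ≥ 1]`. [cite: BettinGonek2017, §2] -/
theorem norm_kernelLine_three_le_indicator {ρ₀ : ℂ} (hζ : riemannZeta ρ₀ = 0)
    (hβ : 1 / 2 ≤ ρ₀.re) (t : ℝ) {r : ℝ} (hr : 0 < r) :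
    ‖kernelLine ρ₀ t 3 r‖ ≤ if 1 ≤ r then 625 * π else 0 := by
  split_ifs with h
  · exact norm_kernelLine_three_le hζ hβ t h
  · rw [kernelLine_three_eq_zero hζ hβ t hr (not_le.1 h), norm_zero]

/-! ## `G_t H_t` is a rational function -/

/-- The rational function `G_t(w) H_t(w) = (w − 3/2 + it)/((w+1)²(w − ½ + it − ρ₀)(w+1+it)⁶)`
(with our exponent `6`); its only pole with `Re w ≥ 0` is `w₁ = ρ₀ + ½ − it`.
[cite: BettinGonek2017, §2] -/
def ratFun (ρ₀ : ℂ) (t : ℝ) (w : ℂ) : ℂ :=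
  (w - 3 / 2 + t * I) / ((w + 1) ^ 2 * (w - 1 / 2 + t * I - ρ₀) * (w + 1 + t * I) ^ 6)

/-- On `Re w > 3/2`: `G_t(w) · 1/((w−1)² ζ(w−½+it)) = ratFun ρ₀ t w` (the pole of `ζ` and the
zero `ρ₀` cancel inside `zetaQuot`). [cite: BettinGonek2017, §2] -/
theorem kernel_mul_inv_eq_ratFun {ρ₀ : ℂ} (hζ : riemannZeta ρ₀ = 0) {t : ℝ} {w : ℂ}
    (hw : 3 / 2 < w.re) :
    kernel ρ₀ t w * ((riemannZeta (w - 1 / 2 + t * I))⁻¹ / (w - 1) ^ 2) = ratFun ρ₀ t w := by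
  have hβ1 := Literature.NumberTheory.LFunctions.re_lt_one_of_riemannZeta_eq_zero hζ
  set z : ℂ := w - 1 / 2 + t * I with hz
  have hzre : 1 < z.re := by simp [hz]; linarith
  have hζz : riemannZeta z ≠ 0 := riemannZeta_ne_zero_of_one_le_re hzre.le
  have hz1 : z ≠ 1 := by intro h; rw [h] at hzre; simp at hzre
  have hzρ : z ≠ ρ₀ := by intro h; rw [h] at hzre; linarith
  have hzρ' : z - ρ₀ ≠ 0 := sub_ne_zero.2 hzρ
  have hw1 : w - 1 ≠ 0 := by
    intro h; have := congrArg Complex.re h; simp at this; linarith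
  have hA1 : w + 1 ≠ 0 := by
    intro h; have := congrArg Complex.re h; simp at this; linarith
  have hA2 : w + 1 + t * I ≠ 0 := by
    intro h; have := congrArg Complex.re h; simp at this; linarith
  have hq : zetaQuot ρ₀ z = (z - 1) * riemannZeta z / (z - ρ₀) := by
    rw [zetaQuot_eq hζ hzρ, Literature.NumberTheory.LFunctions.riemannZeta₁_eq_mul hz1]
  have e1 : w - 3 / 2 + t * I = z - 1 := by rw [hz]; ring
  unfold kernel ratFun
  rw [← hz, hq, e1]
  field_simp

end BettinGonek2017

end Literature.Barriers.RiemannHypothesis
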